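import Mathlib
import Summits.PneNP.PneNP.Theorems.CnfIdealGenLengthRankDefectRepresentationsSharpAntipodal

/-!
# Crux `RankDefectRepresentations` (stmt-PneNP-18923), line `rank-dehn-ladder`: ADJACENT DOMINATION ON AN INTERVAL (registered tool stub
# `stub_adjacentInterval`, lead g15 RESHAPE 10, worker W5; memo `Cruxes/RankDefectRepresentations/Lines/rank-dehn-ladder-g15.md` §4)

Setting (two-family instances, as in `Theorems/…TwoFamilyCutDomination`, `…QuadrantCapture`, `…SharpAntipodal`): rows `x : ι` and columns
`y : ι'` of a matrix `D` carry first-family colours `colourI (row x) : Fin n → Bool` and second-family colours `colourJ (row x) : Fin n' → Bool`.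
For a double cut `(B, B′)` the quadrant `B × B′` consists of the rows / columns whose colour pair lies in `B × B′`; the ADJACENT quadrant
`B × B′ᶜ` has the internal rectangles `R¹²(S,T′)` = rows of types `S × T′`, columns of types `(B ∖ S) × (B′ᶜ ∖ T′)` (`S ⊆ B`, `T′ ⊆ B′ᶜ`).

THEOREM (`stub_adjacentInterval`).  If every first rectangle `rect row col B B′ true true D` of `D` has rank `≤ c₀`, then for `(B,B′)`,
first-family label sets `U, V` and `S′₁ ⊆ B′`, the ANCHOR = the sub-matrix of the quadrant `B × B′` with rows of types `U × S′₁` and columns of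
types `V × (B′ ∖ S′₁)`, of rank `a`, yields ONE matrix `W` of rank `≤ a` such that EVERY internal rectangle `R¹²(S,T′)` of the adjacent quadrant
of `D − W` with `U ⊆ S ⊆ B ∖ V` (and `T′ ⊆ B′ᶜ`) has rank `≤ c₀ − a`.  PROOF (the Schur argument of `…SharpAntipodal.stub_sharpAntipodal`,
p708234, with one containment check changed).  Take an invertible `a × a` minor `A = D[X₀,Y₀]` of the anchor (`exists_submatrix_det_ne_zero`)
and `W := D[·,Y₀] · A⁻¹ · D[X₀,·]`.  For `U ⊆ S ⊆ B ∖ V`, `T′ ⊆ B′ᶜ` the block matrix `M = [[A, E],[F, G]]` with rows `X₀ ∪ rows(S × T′)` and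
columns `Y₀ ∪ cols((B∖S) × (B′ᶜ∖T′))` is a submatrix of the first rectangle `rect row col S (S′₁ ∪ T′) true true D`: anchor rows have first colour
in `U ⊆ S` and second colour in `S′₁`; rectangle rows have colours in `S × T′`; anchor columns have first colour in `V`, which misses `S ⊆ B ∖ V`,
and second colour in `B′ ∖ S′₁`, which misses `S′₁` and `T′ ⊆ B′ᶜ`; rectangle columns have first colour in `B ∖ S` and second colour in
`B′ᶜ ∖ T′`, which misses `S′₁ ⊆ B′`.  Hence `rank M ≤ c₀`, and the LDU factorisation (`rank_fromBlocks_of_invertible₁₁`) gives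
`rank M = a + rank (G − F A⁻¹ E) = a + rank R¹²(S,T′)(D − W)`.  It records exactly how far Schur domination reaches for ADJACENT quadrant pairs:
one anchor serves the interval `[U, B ∖ V]` of first-family sets.  (The hypotheses `U ⊆ B`, `V ⊆ B`, `Disjoint U V` of the registered signature
are not used by the proof.)
HONEST FRAMING: elementary linear algebra in the negative (tool) lane of the crux; P ≠ NP is not moved; F-N2 is a FRONTIER formal rung.
-/

set_option linter.dupNamespace false -- `Summit.PneNP.PneNP.…`: summit = sub-problem name (D-0017)

namespace Summit.PneNP.PneNP.Theorems.CnfIdealGenLengthRankDefectRepresentationsAdjacentInterval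

open Matrix
open Summit.PneNP.PneNP.Theorems.CnfIdealGenLengthRankDefectRepresentationsTwoFamilyCutDomination (colourI colourJ)
open Summit.PneNP.PneNP.Theorems.CnfIdealGenLengthRankDefectRepresentationsQuadrantCapture (rect rect_apply)
open Summit.PneNP.PneNP.Theorems.CnfIdealGenLengthRankDefectRepresentationsSharpAntipodal (rank_padded_eq rank_fromBlocks_of_invertible₁₁)
open Summit.HodgeConjecture.HodgeConjecture.HodgeLocus.Census.RankReduction (exists_submatrix_det_ne_zero)

/-- **ADJACENT DOMINATION ON AN INTERVAL** (registered stub `stub_adjacentInterval` of `Cruxes/RankDefectRepresentations/Lines/rank_dehn_ladder.lean`,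
lead g15 RESHAPE 10, worker W5).  See the module docstring. -/
theorem stub_adjacentInterval :
    ∀ (K : Type) [Field K] (n n' : ℕ) (ι ι' : Type) [Fintype ι] [Fintype ι'] [DecidableEq ι] [DecidableEq ι']
      (row : ι → Fin n ⊕ Fin n' → Bool) (col : ι' → Fin n ⊕ Fin n' → Bool) (D : Matrix ι ι' K) (c₀ : ℕ),
      (∀ B B', (Summit.PneNP.PneNP.Theorems.CnfIdealGenLengthRankDefectRepresentationsQuadrantCapture.rect row col B B' true true D).rank ≤ c₀) →
      ∀ (B U V : Finset (Fin n → Bool)) (B' S'₁ : Finset (Fin n' → Bool)), U ⊆ B → V ⊆ B → Disjoint U V → S'₁ ⊆ B' →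
        ∃ W : Matrix ι ι' K,
          W.rank ≤ (Matrix.of fun x y =>
              if Summit.PneNP.PneNP.Theorems.CnfIdealGenLengthRankDefectRepresentationsTwoFamilyCutDomination.colourI (row x) ∈ U ∧
                  Summit.PneNP.PneNP.Theorems.CnfIdealGenLengthRankDefectRepresentationsTwoFamilyCutDomination.colourJ (row x) ∈ S'₁ ∧
                  Summit.PneNP.PneNP.Theorems.CnfIdealGenLengthRankDefectRepresentationsTwoFamilyCutDomination.colourI (col y) ∈ V ∧
                  Summit.PneNP.PneNP.Theorems.CnfIdealGenLengthRankDefectRepresentationsTwoFamilyCutDomination.colourJ (col y) ∈ B' \ S'₁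
              then D x y else 0).rank ∧
          ∀ (S : Finset (Fin n → Bool)) (T' : Finset (Fin n' → Bool)), U ⊆ S → S ⊆ B \ V → T' ⊆ B'ᶜ →
            (Matrix.of fun x y =>
                if Summit.PneNP.PneNP.Theorems.CnfIdealGenLengthRankDefectRepresentationsTwoFamilyCutDomination.colourI (row x) ∈ S ∧
                    Summit.PneNP.PneNP.Theorems.CnfIdealGenLengthRankDefectRepresentationsTwoFamilyCutDomination.colourJ (row x) ∈ T' ∧
                    Summit.PneNP.PneNP.Theorems.CnfIdealGenLengthRankDefectRepresentationsTwoFamilyCutDomination.colourI (col y) ∈ B \ S ∧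
                    Summit.PneNP.PneNP.Theorems.CnfIdealGenLengthRankDefectRepresentationsTwoFamilyCutDomination.colourJ (col y) ∈ B'ᶜ \ T'
                then (D - W) x y else 0).rank +
              (Matrix.of fun x y =>
                if Summit.PneNP.PneNP.Theorems.CnfIdealGenLengthRankDefectRepresentationsTwoFamilyCutDomination.colourI (row x) ∈ U ∧
                    Summit.PneNP.PneNP.Theorems.CnfIdealGenLengthRankDefectRepresentationsTwoFamilyCutDomination.colourJ (row x) ∈ S'₁ ∧
                    Summit.PneNP.PneNP.Theorems.CnfIdealGenLengthRankDefectRepresentationsTwoFamilyCutDomination.colourI (col y) ∈ V ∧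
                    Summit.PneNP.PneNP.Theorems.CnfIdealGenLengthRankDefectRepresentationsTwoFamilyCutDomination.colourJ (col y) ∈ B' \ S'₁
                then D x y else 0).rank ≤ c₀ := by
  intro K _ n n' ι ι' _ _ _ _ row col D c₀ hrect B U V B' S'₁ _ _ _ hS'
  classical
  -- the anchor (rows of types `U × S′₁`, columns of types `V × (B′ ∖ S′₁)`) and an invertible maximal minor of it
  set R₁ : Matrix ι ι' K := Matrix.of fun x y =>
      if colourI (row x) ∈ U ∧ colourJ (row x) ∈ S'₁ ∧ colourI (col y) ∈ V ∧ colourJ (col y) ∈ B' \ S'₁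
      then D x y else 0 with hR₁
  obtain ⟨rows, cols, hdet⟩ := exists_submatrix_det_ne_zero R₁
  set A : Matrix (Fin R₁.rank) (Fin R₁.rank) K := R₁.submatrix rows cols with hAdef
  -- the selected rows/columns lie in the anchor types (otherwise a zero row/column of `A`)
  have hrows : ∀ i, colourI (row (rows i)) ∈ U ∧ colourJ (row (rows i)) ∈ S'₁ := by
    intro i
    by_contra h
    apply hdet
    refine Matrix.det_eq_zero_of_row_eq_zero i fun j => ?_
    simp only [hAdef, Matrix.submatrix_apply, hR₁, Matrix.of_apply]
    rw [if_neg]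
    tauto
  have hcols : ∀ j, colourI (col (cols j)) ∈ V ∧ colourJ (col (cols j)) ∈ B' \ S'₁ := by
    intro j
    by_contra h
    apply hdet
    refine Matrix.det_eq_zero_of_column_eq_zero j fun i => ?_
    simp only [hAdef, Matrix.submatrix_apply, hR₁, Matrix.of_apply]
    rw [if_neg]
    tauto
  have hA : ∀ i j, A i j = D (rows i) (cols j) := by
    intro i j
    simp only [hAdef, Matrix.submatrix_apply, hR₁, Matrix.of_apply]
    rw [if_pos ⟨(hrows i).1, (hrows i).2, (hcols j).1, (hcols j).2⟩]
  haveI : Invertible A := A.invertibleOfIsUnitDet (isUnit_iff_ne_zero.mpr hdet)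
  -- the dominating matrix
  set P : Matrix ι (Fin R₁.rank) K := Matrix.of fun x j => D x (cols j) with hP
  set Q : Matrix (Fin R₁.rank) ι' K := Matrix.of fun i y => D (rows i) y with hQ
  refine ⟨P * ⅟A * Q, ?_, ?_⟩
  · calc (P * ⅟A * Q).rank ≤ (P * ⅟A).rank := Matrix.rank_mul_le_left _ _
      _ ≤ P.rank := Matrix.rank_mul_le_left _ _
      _ ≤ Fintype.card (Fin R₁.rank) := Matrix.rank_le_card_width _
      _ = R₁.rank := Fintype.card_fin _
  · intro S T' hUS hSBV hT'
    -- row / column index types of the adjacent rectangle `R¹²(S,T′)`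
    let ρ := {x : ι // colourI (row x) ∈ S ∧ colourJ (row x) ∈ T'}
    let κ := {y : ι' // colourI (col y) ∈ B \ S ∧ colourJ (col y) ∈ B'ᶜ \ T'}
    set E : Matrix (Fin R₁.rank) κ K := Q.submatrix id Subtype.val with hE
    set F : Matrix ρ (Fin R₁.rank) K := P.submatrix Subtype.val id with hF
    set G : Matrix ρ κ K := D.submatrix Subtype.val Subtype.val with hG
    set M : Matrix (Fin R₁.rank ⊕ ρ) (Fin R₁.rank ⊕ κ) K := Matrix.fromBlocks A E F G with hM
    -- (1) `M` is a submatrix of the first rectangle of `D` at `(S, S′₁ ∪ T′)`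
    set T : Matrix ι ι' K := rect row col S (S'₁ ∪ T') true true D with hT
    have hTD : ∀ (u : Fin R₁.rank ⊕ ρ) (v : Fin R₁.rank ⊕ κ),
        T (Sum.elim rows Subtype.val u) (Sum.elim cols Subtype.val v) = D (Sum.elim rows Subtype.val u) (Sum.elim cols Subtype.val v) := by
      intro u v
      have hr : colourI (row (Sum.elim rows Subtype.val u)) ∈ S ∧ colourJ (row (Sum.elim rows Subtype.val u)) ∈ S'₁ ∪ T' := by
        rcases u with i | x
        · exact ⟨hUS (hrows i).1, Finset.mem_union_left _ (hrows i).2⟩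
        · exact ⟨x.2.1, Finset.mem_union_right _ x.2.2⟩
      have hc : colourI (col (Sum.elim cols Subtype.val v)) ∉ S ∧ colourJ (col (Sum.elim cols Subtype.val v)) ∉ S'₁ ∪ T' := by
        rcases v with j | y
        · have h1 := (hcols j).1
          have h2 := (hcols j).2
          rw [Finset.mem_sdiff] at h2
          refine ⟨?_, ?_⟩
          · intro h
            exact (Finset.mem_sdiff.mp (hSBV h)).2 h1
          · rw [Finset.mem_union, not_or]
            exact ⟨h2.2, fun h => (Finset.mem_compl.mp (hT' h)) h2.1⟩
        · have h1 := y.2.1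
          have h2 := y.2.2
          rw [Finset.mem_sdiff] at h1
          rw [Finset.mem_sdiff, Finset.mem_compl] at h2
          refine ⟨h1.2, ?_⟩
          rw [Finset.mem_union, not_or]
          exact ⟨fun h => h2.1 (hS' h), h2.2⟩
      have hcond : (decide (colourI (row (Sum.elim rows Subtype.val u)) ∈ S) = true ∧
            decide (colourJ (row (Sum.elim rows Subtype.val u)) ∈ S'₁ ∪ T') = true) ∧
          (decide (colourI (col (Sum.elim cols Subtype.val v)) ∈ S) = !true ∧
            decide (colourJ (col (Sum.elim cols Subtype.val v)) ∈ S'₁ ∪ T') = !true) := by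
        simp only [Bool.not_true, decide_eq_true_eq, decide_eq_false_iff_not]
        exact ⟨hr, hc⟩
      rw [hT, rect_apply, if_pos hcond]
    have hMT : M = T.submatrix (Sum.elim rows Subtype.val) (Sum.elim cols Subtype.val) := by
      ext u v
      rw [Matrix.submatrix_apply, hTD]
      rcases u with i | x <;> rcases v with j | y
      · simp [hM, hA]
      · simp [hM, hE, hQ]
      · simp [hM, hF, hP]
      · simp [hM, hG]
    have hMc : M.rank ≤ c₀ := by
      rw [hMT]
      exact (Matrix.rank_submatrix_le _ _ _).trans (hrect _ _)
    -- (2) Schur: `rank M = a + rank (G − F A⁻¹ E)`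
    have hArank : A.rank = R₁.rank := by
      rw [Matrix.rank_of_isUnit A ((Matrix.isUnit_iff_isUnit_det A).mpr (isUnit_iff_ne_zero.mpr hdet)), Fintype.card_fin]
    have hSchur := rank_fromBlocks_of_invertible₁₁ A E F G
    -- (3) the Schur complement is the adjacent rectangle of `D − W`
    have hSW : G - F * ⅟A * E = (D - P * ⅟A * Q).submatrix (Subtype.val : ρ → ι) (Subtype.val : κ → ι') := by
      rw [Matrix.submatrix_sub, hG, hF, hE]
      congr 1
    have hpad := rank_padded_eq (fun x : ι => colourI (row x) ∈ S ∧ colourJ (row x) ∈ T')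
      (fun y : ι' => colourI (col y) ∈ B \ S ∧ colourJ (col y) ∈ B'ᶜ \ T') (D - P * ⅟A * Q)
    have e4 : (Matrix.of fun x y =>
        if colourI (row x) ∈ S ∧ colourJ (row x) ∈ T' ∧ colourI (col y) ∈ B \ S ∧ colourJ (col y) ∈ B'ᶜ \ T'
        then (D - P * ⅟A * Q) x y else 0) =
        (Matrix.of fun x y =>
          if (colourI (row x) ∈ S ∧ colourJ (row x) ∈ T') ∧ (colourI (col y) ∈ B \ S ∧ colourJ (col y) ∈ B'ᶜ \ T')
          then (D - P * ⅟A * Q) x y else 0) := by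
      ext x y
      simp only [Matrix.of_apply, and_assoc]
    rw [e4, hpad, ← hSW]
    have h1 : A.rank + (G - F * ⅟A * E).rank ≤ c₀ := by
      rw [← hSchur, ← hM]; exact hMc
    rw [hArank] at h1
    omega

end Summit.PneNP.PneNP.Theorems.CnfIdealGenLengthRankDefectRepresentationsAdjacentInterval
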